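import Mathlib
import Summits.ValiantsHypothesis.ValiantsHypothesis.Theorems.RigidityForcesSymmetryRankRigidMinimalReprLaplaceFiveSeparatedCaptureDisjointPairFour
import Summits.ValiantsHypothesis.ValiantsHypothesis.Theorems.RigidityForcesSymmetryRankRigidMinimalReprLaplaceFiveSeparatedCaptureTwoLines
import Summits.ValiantsHypothesis.ValiantsHypothesis.Theorems.RigidityForcesSymmetryRankRigidMinimalReprLaplaceFiveSeparatedCaptureLinesK1

/-!
# ValiantsHypothesis / RigidityForcesSymmetry — crux `LaplaceOptimalFive` (stmt-ValiantsHypothesis-24813), symmetric capture: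
# **RELABELLED PROFILES** (S₃-images of ✓ `captureIneqSym_of_disjoint_pair_four` and ✓ `captureIneqSym_of_two_lines`)

(val-port-2 g5 ↔ crit-3 g9, 2026-08-29.)  The clause of `CaptureIneqSym` is invariant under permuting the three triangle spans: an
obligation is a fully symmetric tensor, and the tree's transport lemmas ✓ `contractZ_mem_L3_swap23`, ✓ `contractZ_mem_L3_swap13`
(`…SeparatedCaptureLinesK1`, val-lit-p6 g18) re-read a captured obligation with two spans exchanged.  Corollaries: the disjoint-pair
theorem for ANY two of the three cuts (total finrank ≤ 4, remaining span of finrank ≤ 2), and the two-lines theorem for lines on ANY two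
cuts (remaining span of finrank ≤ 2).  No new profile family beyond S₃-images.

* ★★ `captureIneqSym_of_disjoint_pair_four_01_12`, ★★ `captureIneqSym_of_disjoint_pair_four_02_12`.
* ★ `captureIneqSym_of_two_lines_01_12`, ★ `captureIneqSym_of_two_lines_02_12`.

Honest framing.  After these, every profile with all three finranks ≤ 2 is proved EXCEPT the fully pairwise-intersecting ones
((1,2,2)♭ with the line inside both planes; (2,2,2)♭ not all equal); `CaptureIneqSym` in general, K1 on `K₃ ⊔ K₂`, `LaplaceOptimalFive`
(OPEN · CONTESTED 72/120) and `VP ≠ VNP` are NOT proved here.  No definitions, no `sorry`.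
-/

set_option linter.dupNamespace false
set_option autoImplicit false

namespace Summit.ValiantsHypothesis.ValiantsHypothesis.Theorems.RigidityForcesSymmetryRankRigidMinimalRepr

namespace LaplaceFiveSeparatedCapture

open Finset

/-- ★★ Disjoint pair on the cuts `01, 12` (total finrank ≤ 4), the span on `02` of finrank ≤ 2. [folklore] -/
theorem captureIneqSym_of_disjoint_pair_four_01_12 (U01 U02 U12 W : Submodule ℂ (Fin 5 → Fin 5 → ℂ))
    (h01 : ∀ x ∈ U01, ∀ p q : Fin 5, x p q = x q p) (h02 : ∀ x ∈ U02, ∀ p q : Fin 5, x p q = x q p)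
    (h12 : ∀ x ∈ U12, ∀ p q : Fin 5, x p q = x q p) (hdis : U01 ⊓ U12 = ⊥)
    (h4 : Module.finrank ℂ U01 + Module.finrank ℂ U12 ≤ 4) (hd : Module.finrank ℂ U02 ≤ 2)
    (hWs : ∀ μ ∈ W, ∀ s t : Fin 5, μ s t = μ t s) (hWd : ∀ μ ∈ W, ∀ s : Fin 5, μ s s = 0)
    (hWc : ∀ μ ∈ W, contractZ μ ∈ L3 U01 U02 U12) :
    Module.finrank ℂ W ≤ Module.finrank ℂ U01 + Module.finrank ℂ U02 + Module.finrank ℂ U12 := by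
  have hWc' : ∀ μ ∈ W, contractZ μ ∈ L3 U01 U12 U02 := fun μ hμ =>
    contractZ_mem_L3_swap23 U01 U02 U12 h01 μ (hWc μ hμ)
  have h := captureIneqSym_of_disjoint_pair_four U01 U12 U02 W h01 h12 h02 hdis h4 hd hWs hWd hWc'
  omega

/-- ★★ Disjoint pair on the cuts `02, 12` (total finrank ≤ 4), the span on `01` of finrank ≤ 2. [folklore] -/
theorem captureIneqSym_of_disjoint_pair_four_02_12 (U01 U02 U12 W : Submodule ℂ (Fin 5 → Fin 5 → ℂ))
    (h01 : ∀ x ∈ U01, ∀ p q : Fin 5, x p q = x q p) (h02 : ∀ x ∈ U02, ∀ p q : Fin 5, x p q = x q p)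
    (h12 : ∀ x ∈ U12, ∀ p q : Fin 5, x p q = x q p) (hdis : U02 ⊓ U12 = ⊥)
    (h4 : Module.finrank ℂ U02 + Module.finrank ℂ U12 ≤ 4) (hd : Module.finrank ℂ U01 ≤ 2)
    (hWs : ∀ μ ∈ W, ∀ s t : Fin 5, μ s t = μ t s) (hWd : ∀ μ ∈ W, ∀ s : Fin 5, μ s s = 0)
    (hWc : ∀ μ ∈ W, contractZ μ ∈ L3 U01 U02 U12) :
    Module.finrank ℂ W ≤ Module.finrank ℂ U01 + Module.finrank ℂ U02 + Module.finrank ℂ U12 := by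
  have hWc' : ∀ μ ∈ W, contractZ μ ∈ L3 U12 U02 U01 := fun μ hμ =>
    contractZ_mem_L3_swap13 U01 U02 U12 h01 h02 h12 μ (hWc μ hμ)
  have hdis' : U12 ⊓ U02 = ⊥ := by rw [inf_comm]; exact hdis
  have h := captureIneqSym_of_disjoint_pair_four U12 U02 U01 W h12 h02 h01 hdis' (by omega) hd hWs hWd hWc'
  omega

/-- ★ Two lines on the cuts `01, 12`, the span on `02` of finrank ≤ 2. [folklore] -/
theorem captureIneqSym_of_two_lines_01_12 (u₁ u₃ : Fin 5 → Fin 5 → ℂ)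
    (hu₁ : ∀ p q, u₁ p q = u₁ q p) (hu₃ : ∀ p q, u₃ p q = u₃ q p) (h₁ : u₁ ≠ 0) (h₃ : u₃ ≠ 0)
    (U02 W : Submodule ℂ (Fin 5 → Fin 5 → ℂ)) (hU02 : ∀ x ∈ U02, ∀ p q : Fin 5, x p q = x q p)
    (hd : Module.finrank ℂ U02 ≤ 2)
    (hWs : ∀ μ ∈ W, ∀ s t : Fin 5, μ s t = μ t s) (hWd : ∀ μ ∈ W, ∀ s : Fin 5, μ s s = 0)
    (hWc : ∀ μ ∈ W, contractZ μ ∈ L3 (ℂ ∙ u₁) U02 (ℂ ∙ u₃)) :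
    Module.finrank ℂ W ≤ Module.finrank ℂ (ℂ ∙ u₁) + Module.finrank ℂ U02 + Module.finrank ℂ (ℂ ∙ u₃) := by
  have hs1 : ∀ x ∈ (ℂ ∙ u₁), ∀ p q : Fin 5, x p q = x q p := by
    intro x hx p q
    obtain ⟨c, rfl⟩ := Submodule.mem_span_singleton.mp hx
    simp only [Pi.smul_apply, smul_eq_mul, hu₁ p q]
  have hWc' : ∀ μ ∈ W, contractZ μ ∈ L3 (ℂ ∙ u₁) (ℂ ∙ u₃) U02 := fun μ hμ =>
    contractZ_mem_L3_swap23 (ℂ ∙ u₁) U02 (ℂ ∙ u₃) hs1 μ (hWc μ hμ)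
  have h := captureIneqSym_of_two_lines u₁ u₃ hu₁ hu₃ h₁ h₃ U02 W hU02 hd hWs hWd hWc'
  omega

/-- ★ Two lines on the cuts `02, 12`, the span on `01` of finrank ≤ 2. [folklore] -/
theorem captureIneqSym_of_two_lines_02_12 (u₂ u₃ : Fin 5 → Fin 5 → ℂ)
    (hu₂ : ∀ p q, u₂ p q = u₂ q p) (hu₃ : ∀ p q, u₃ p q = u₃ q p) (h₂ : u₂ ≠ 0) (h₃ : u₃ ≠ 0)
    (U01 W : Submodule ℂ (Fin 5 → Fin 5 → ℂ)) (hU01 : ∀ x ∈ U01, ∀ p q : Fin 5, x p q = x q p)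
    (hd : Module.finrank ℂ U01 ≤ 2)
    (hWs : ∀ μ ∈ W, ∀ s t : Fin 5, μ s t = μ t s) (hWd : ∀ μ ∈ W, ∀ s : Fin 5, μ s s = 0)
    (hWc : ∀ μ ∈ W, contractZ μ ∈ L3 U01 (ℂ ∙ u₂) (ℂ ∙ u₃)) :
    Module.finrank ℂ W ≤ Module.finrank ℂ U01 + Module.finrank ℂ (ℂ ∙ u₂) + Module.finrank ℂ (ℂ ∙ u₃) := by
  have hs2 : ∀ x ∈ (ℂ ∙ u₂), ∀ p q : Fin 5, x p q = x q p := by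
    intro x hx p q
    obtain ⟨c, rfl⟩ := Submodule.mem_span_singleton.mp hx
    simp only [Pi.smul_apply, smul_eq_mul, hu₂ p q]
  have hs3 : ∀ x ∈ (ℂ ∙ u₃), ∀ p q : Fin 5, x p q = x q p := by
    intro x hx p q
    obtain ⟨c, rfl⟩ := Submodule.mem_span_singleton.mp hx
    simp only [Pi.smul_apply, smul_eq_mul, hu₃ p q]
  have hWc' : ∀ μ ∈ W, contractZ μ ∈ L3 (ℂ ∙ u₃) (ℂ ∙ u₂) U01 := fun μ hμ =>
    contractZ_mem_L3_swap13 U01 (ℂ ∙ u₂) (ℂ ∙ u₃) hU01 hs2 hs3 μ (hWc μ hμ)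
  have h := captureIneqSym_of_two_lines u₃ u₂ hu₃ hu₂ h₃ h₂ U01 W hU01 hd hWs hWd hWc'
  omega

end LaplaceFiveSeparatedCapture

end Summit.ValiantsHypothesis.ValiantsHypothesis.Theorems.RigidityForcesSymmetryRankRigidMinimalRepr
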